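import Literature.NumberTheory.DiophantineGeometry.FunctionFieldHurwitzTame
import Mathlib.RingTheory.Artinian.Module
import Mathlib.RingTheory.Valuation.LocalSubring
import HarnessLib

/-!
# Unramifiedness read off from affine charts with reduced finite fibres; `F = K(t)`

Topic: `Literature/NumberTheory/DiophantineGeometry`. The commutative algebra linking a finite étale
cover `Y → ℙ¹_K` (`K` algebraically closed) to the function-field statement
`adjoin_simple_eq_top_of_unramified` of `FunctionFieldHurwitzTame` (an everywhere unramified
`t ∉ K` generates the algebraic function field `F/K`). For a place `P` of `F/K` and a subalgebra
`B ⊆ 𝒪_P` with `Frac B = F` ("an affine chart of `Y` containing the centre of `P`") and an element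
`ϖ ∈ B ∩ 𝔪_P` whose fibre ring `B/ϖB` is **reduced and Artinian** ("the fibre of the chart over
`ϖ = 0` is finite étale over `K`"), we prove `v_P(ϖ) = 1` (`PlaceOver.ord_eq_one_of_isReduced`):
the prime `𝔮 = 𝔪_P ∩ B` is one of the finitely many maximal ideals of `B` over `ϖ`, the reduced
Artinian `B/ϖB` splits off the factor `B/𝔮` (`IsArtinianRing.equivPi`), giving `s ∉ 𝔮` with
`s 𝔮 ⊆ ϖ B`, i.e. `𝔮 B_𝔮 = ϖ B_𝔮` — so `B_𝔮` is a discrete valuation ring with parameter `ϖ`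
dominated by `𝒪_P` inside `F = Frac B`, hence equal to it; we run this argument directly on
orders: every `0 ≠ x ∈ B` has `v_P(ϖ) ∣ v_P(x)` (peel off `ϖ` while `x ∈ 𝔮`), and a uniformizer of
`P` is a quotient of elements of `B`. Consequently (`adjoin_simple_eq_top_of_charts`): if `t ∉ K`
lies in a chart `B₀` seen by every place where `t` is finite, `t⁻¹` in a chart `B₁` seen by every
pole of `t`, and all the fibre rings `B₀/(t - c)`, `c ∈ K`, and `B₁/(t⁻¹)` are reduced Artinian, then
`t` is unramified everywhere and **`F = K(t)`** (Riemann–Hurwitz, `FunctionFieldHurwitzTame`).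
Also the integrality lemma feeding "`B ⊆ 𝒪_P`" (`PlaceOver.mem_of_isIntegralElem`: valuation rings
are integrally closed). Everything is proved; no named facts.

## References

* H. Stichtenoth, *Algebraic Function Fields and Codes*, 2nd ed., GTM 254 (2009): Thm. 1.1.6,
  Thm. 1.1.13, Prop. 3.2.9, Thm. 3.5.1. [Stichtenoth2009]
* A. Grothendieck, M. Raynaud, SGA 1, Exp. I Cor. 9.11, Exp. XI Prop. 1.1. [SGA1]
-/

noncomputable section

open scoped Classical IntermediateField
open Module

namespace Literature.NumberTheory.DiophantineGeometry.AlgFunctionField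

universe u v

variable {K : Type u} {F : Type v} [Field K] [Field F] [Algebra K F]

namespace PlaceOver

/-! ### Integral elements lie in every valuation ring containing the coefficients -/

/-- If `φ : R → F` takes values in `𝒪_P` and `b ∈ F` is integral over `R` through `φ`, then
`b ∈ 𝒪_P` (valuation rings are integrally closed; Stichtenoth Prop. 3.2.9 / Thm. 3.2.6).
[cite: Stichtenoth2009, Prop. 3.2.9] -/
theorem mem_of_isIntegralElem (P : PlaceOver K F) {R : Type*} [CommRing R] (φ : R →+* F)
    (hφ : ∀ r : R, φ r ∈ P.toValuationSubring) {b : F} (hb : φ.IsIntegralElem b) :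
    b ∈ P.toValuationSubring := by
  set O := P.toValuationSubring
  obtain ⟨p, hpm, hpb⟩ := hb
  -- transport `p` to a monic polynomial over `𝒪_P`
  let φ' : R →+* O := φ.codRestrict O hφ
  have hφ' : (O.subtype).comp φ' = φ := by ext r; rfl
  have hint : IsIntegral O b := by
    refine ⟨p.map φ', hpm.map φ', ?_⟩
    rw [Polynomial.eval₂_map]
    change Polynomial.eval₂ ((algebraMap O F).comp φ') b p = 0
    have : (algebraMap (↥O) F) = O.subtype := rfl
    rw [this, hφ']
    exact hpb
  obtain ⟨y, hy⟩ := (IsIntegrallyClosed.isIntegral_iff (R := O) (K := F)).1 hint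
  rw [← hy]
  exact y.2

/-! ### The order of a parameter whose fibre ring is reduced Artinian -/

/-- **`v_P(ϖ) = 1` when the fibre ring `B/ϖB` is reduced Artinian.** Let `P` be a place of `F/K`,
`B ⊆ 𝒪_P` a `K`-subalgebra of `F` with `Frac B = F`, and `ϖ ∈ B ∩ 𝔪_P`, `ϖ ≠ 0`, such that
`B/ϖB` is reduced and Artinian (for the coordinate ring `B` of an affine chart of a curve finite
étale over `𝔸¹ = Spec K[ϖ]`: the fibre over `ϖ = 0` is finite étale over `K`). Then `v_P(ϖ) = 1`:
the place `P` is unramified over `K(ϖ)`. Proof: the centre `𝔮 = 𝔪_P ∩ B` is a prime over `ϖ`,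
hence one of the finitely many maximal ideals `𝔪ᵢ` of the reduced Artinian `B/ϖB ≅ ∏ B/𝔪ᵢ`
(`IsArtinianRing.equivPi`); the idempotent supported at the factor `𝔮` lifts to `s ∈ B ∖ 𝔮` with
`s · 𝔮 ⊆ ϖB` (`𝔮 B_𝔮 = ϖ B_𝔮`). So every `x ∈ 𝔮` satisfies `s x = ϖ x'`, `x' ∈ B`,
`v_P(x') = v_P(x) - v_P(ϖ)`; by induction `v_P(ϖ) ∣ v_P(x)` for all `0 ≠ x ∈ B`, hence on all of
`F^× = (Frac B)^×`, and `v_P` takes the value `1`. (Equivalently: `B_𝔮` is a discrete valuation ring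
with parameter `ϖ`, and `𝒪_P ⊇ B_𝔮` with the same fraction field forces `𝒪_P = B_𝔮`,
Stichtenoth Thm. 1.1.6 / Thm. 3.5.1 with `d(P) = e(P) - 1 = 0`.) [cite: Stichtenoth2009, Thm. 3.5.1] -/
theorem ord_eq_one_of_isReduced (P : PlaceOver K F) {B : Subalgebra K F}
    (hBO : ∀ b ∈ B, (b : F) ∈ P.toValuationSubring)
    (hfrac : ∀ f : F, ∃ a ∈ B, ∃ b ∈ B, b ≠ 0 ∧ f * b = a)
    {ϖ : F} (hϖB : ϖ ∈ B) (hϖ0 : ϖ ≠ 0) (hϖP : P.valuation ϖ < 1)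
    [IsReduced (B ⧸ Ideal.span {(⟨ϖ, hϖB⟩ : B)})]
    [IsArtinianRing (B ⧸ Ideal.span {(⟨ϖ, hϖB⟩ : B)})] :
    P.ord ϖ = 1 := by
  set O := P.toValuationSubring with hO
  set ϖ' : B := ⟨ϖ, hϖB⟩ with hϖ'
  set I : Ideal B := Ideal.span {ϖ'} with hI
  -- the centre `𝔮 = 𝔪_P ∩ B` of `P` on the chart `B`
  let ψ : B →+* O := (B.val : B →+* F).codRestrict O fun b ↦ hBO b b.2
  set 𝔮 : Ideal B := (IsLocalRing.maximalIdeal O).comap ψ with h𝔮def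
  have hmem𝔮 : ∀ b : B, b ∈ 𝔮 ↔ P.valuation (b : F) < 1 := fun b ↦ by
    rw [h𝔮def, Ideal.mem_comap, ValuationSubring.valuation_lt_one_iff]
    rfl
  haveI h𝔮p : 𝔮.IsPrime := Ideal.IsPrime.comap _
  have hord0 : ∀ b : B, b ∉ 𝔮 → P.ord (b : F) = 0 := fun b hb ↦ by
    rw [hmem𝔮, not_lt] at hb
    have h1 : P.valuation (b : F) = 1 := le_antisymm (O.valuation_le_one ⟨b, hBO b b.2⟩) hb
    exact P.ord_eq_zero_of_isUnit (hBO b b.2) ((O.valuation_eq_one_iff _).2 h1)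
  have hϖq : ϖ' ∈ 𝔮 := (hmem𝔮 ϖ').2 hϖP
  have hIq : I ≤ 𝔮 := by
    rw [hI, Ideal.span_singleton_le_iff_mem]
    exact hϖq
  -- splitting off the centre in the reduced Artinian fibre: `s ∉ 𝔮` with `s 𝔮 ⊆ ϖ B`
  obtain ⟨s, hsq, hs⟩ : ∃ s : B, s ∉ 𝔮 ∧ ∀ x ∈ 𝔮, s * x ∈ I := by
    set Q := B ⧸ I
    have hker : RingHom.ker (Ideal.Quotient.mk I) ≤ 𝔮 := by rwa [Ideal.mk_ker]
    set qb : Ideal Q := 𝔮.map (Ideal.Quotient.mk I) with hqb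
    haveI hqbp : qb.IsPrime := Ideal.map_isPrime_of_surjective Ideal.Quotient.mk_surjective hker
    let m₀ : MaximalSpectrum Q := ⟨qb, IsArtinianRing.isMaximal_of_isPrime qb⟩
    set e := IsArtinianRing.equivPi Q
    let sb : Q := e.symm (Pi.single m₀ 1)
    obtain ⟨s, hs⟩ := Ideal.Quotient.mk_surjective sb
    have hmem : ∀ (x : Q) (m : MaximalSpectrum Q), x ∈ m.asIdeal ↔ e x m = 0 := fun x m ↦ by
      rw [IsArtinianRing.equivPi_apply, Ideal.Quotient.eq_zero_iff_mem]
    have hesb : e sb = Pi.single m₀ 1 := e.apply_symm_apply _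
    refine ⟨s, ?_, fun x hx ↦ ?_⟩
    · intro hsq
      have h1 : sb ∈ qb := by rw [← hs]; exact Ideal.mem_map_of_mem _ hsq
      have h2 := (hmem sb m₀).1 h1
      rw [hesb, Pi.single_eq_same] at h2
      exact one_ne_zero h2
    · rw [← Ideal.Quotient.eq_zero_iff_mem, map_mul, hs]
      have hxq : Ideal.Quotient.mk I x ∈ qb := Ideal.mem_map_of_mem _ hx
      apply e.injective
      rw [map_mul, map_zero, hesb]
      funext m
      rw [Pi.mul_apply, Pi.zero_apply]
      by_cases hm : m = m₀
      · subst hm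
        rw [(hmem _ m₀).1 hxq, mul_zero]
      · rw [Pi.single_eq_of_ne hm, zero_mul]
  have hs0 : (s : F) ≠ 0 := by
    intro h
    apply hsq
    have : s = 0 := Subtype.ext h
    rw [this]
    exact zero_mem _
  have hords : P.ord (s : F) = 0 := hord0 s hsq
  set d := P.ord ϖ with hd
  have hdpos : 0 < d := (P.valuation_lt_one_iff_ord_pos hϖ0).1 hϖP
  -- `v_P(ϖ) ∣ v_P(x)` for every `0 ≠ x ∈ B`
  have key : ∀ n : ℕ, ∀ x : B, (x : F) ≠ 0 → P.ord (x : F) < n → d ∣ P.ord (x : F) := by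
    intro n
    induction n with
    | zero =>
        intro x hx0 hlt
        have := P.ord_nonneg_of_mem (hBO x x.2)
        omega
    | succ n ih =>
        intro x hx0 hlt
        by_cases hxq : x ∈ 𝔮
        · -- peel off one `ϖ`: `s x = x' ϖ`
          obtain ⟨x', hx'⟩ := Ideal.mem_span_singleton'.1 (hs x hxq)
          have hF : (s : F) * x = (x' : F) * ϖ := by
            have := congrArg (fun b : B ↦ (b : F)) hx'
            simpa [hϖ'] using this.symm
          have hx'0 : (x' : F) ≠ 0 := by
            intro h0
            rw [h0, zero_mul] at hF
            exact (mul_ne_zero hs0 hx0) hF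
          have hordeq : P.ord (x : F) = P.ord (x' : F) + d := by
            have h1 := P.ord_mul_eq hs0 hx0
            rw [hF, P.ord_mul_eq hx'0 hϖ0, hords, zero_add] at h1
            rw [hd]; exact h1.symm
          have hlt' : P.ord (x' : F) < n := by omega
          obtain ⟨k, hk⟩ := ih x' hx'0 hlt'
          exact ⟨k + 1, by rw [hordeq, hk]; ring⟩
        · rw [hord0 x hxq]
          exact dvd_zero d
  have hdvd : ∀ x : B, (x : F) ≠ 0 → d ∣ P.ord (x : F) := fun x hx0 ↦
    key ((P.ord (x : F)).toNat + 1) x hx0 (by have := Int.self_le_toNat (P.ord (x : F)); omega)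
  -- a uniformizer of `P` is a quotient of elements of `B`
  set u : F := (P.uniformizer : F) with hu
  have hu1 : P.ord u = 1 := P.ord_uniformizer_eq_one
  have hu0 : u ≠ 0 := P.coe_uniformizer_ne_zero
  obtain ⟨a, haB, b, hbB, hb0, hab⟩ := hfrac u
  have ha0 : a ≠ 0 := by rw [← hab]; exact mul_ne_zero hu0 hb0
  have h1 : P.ord a = 1 + P.ord b := by rw [← hab, P.ord_mul_eq hu0 hb0, hu1]
  have hda := hdvd ⟨a, haB⟩ ha0
  have hdb := hdvd ⟨b, hbB⟩ hb0
  simp only at hda hdb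
  have hd1 : d ∣ 1 := by
    have : d ∣ P.ord a - P.ord b := dvd_sub hda hdb
    rwa [h1, add_sub_cancel_right] at this
  exact Int.eq_one_of_dvd_one hdpos.le hd1

end PlaceOver

/-! ### `F = K(t)` from two charts with reduced Artinian fibres -/

section charts

variable [IsAlgClosed K] [IsAlgFunctionField K F]

/-- **Two unramified charts generate the function field.** Let `K` be algebraically closed, `F/K`
an algebraic function field, `t ∈ F ∖ K`, and `B₀ ∋ t`, `B₁ ∋ t⁻¹` two `K`-subalgebras of `F` with
fraction field `F` such that `B₀ ⊆ 𝒪_P` for every place `P` at which `t` is finite and `B₁ ⊆ 𝒪_P`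
for every pole `P` of `t` (for the cover `Y → ℙ¹_K`: the coordinate rings of `Y` over the two
standard charts, integral over `K[t]` resp. `K[t⁻¹]`). If all the fibre rings `B₀/(t - c)B₀`,
`c ∈ K`, and `B₁/t⁻¹B₁` are reduced and Artinian (the fibres of `Y` over the closed points of `ℙ¹`
are finite étale over `K`), then `F = K(t)`: by `PlaceOver.ord_eq_one_of_isReduced` every place is
unramified over `K(t)` (`v_P(t - t(P)) = 1` or `v_P(t) = -1`), and an everywhere unramified `t`
generates `F` (`adjoin_simple_eq_top_of_unramified`, the Riemann–Hurwitz count of SGA 1 XI 1.1).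
[cite: SGA1, Exp. XI Prop. 1.1 (r = 1)] -/
theorem adjoin_simple_eq_top_of_charts {t : F} (ht : t ∉ Set.range (algebraMap K F))
    (B₀ B₁ : Subalgebra K F)
    (h₀O : ∀ P : PlaceOver K F, t ∈ P.toValuationSubring → ∀ b ∈ B₀, (b : F) ∈ P.toValuationSubring)
    (h₁O : ∀ P : PlaceOver K F, t ∉ P.toValuationSubring → ∀ b ∈ B₁, (b : F) ∈ P.toValuationSubring)
    (h₀frac : ∀ f : F, ∃ a ∈ B₀, ∃ b ∈ B₀, b ≠ 0 ∧ f * b = a)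
    (h₁frac : ∀ f : F, ∃ a ∈ B₁, ∃ b ∈ B₁, b ≠ 0 ∧ f * b = a)
    (ht₀ : t ∈ B₀) (ht₁ : t⁻¹ ∈ B₁)
    (h₀fib : ∀ c : K,
      IsReduced (B₀ ⧸ Ideal.span {(⟨t - algebraMap K F c, sub_mem ht₀ (B₀.algebraMap_mem c)⟩ : B₀)}) ∧
      IsArtinianRing (B₀ ⧸ Ideal.span {(⟨t - algebraMap K F c, sub_mem ht₀ (B₀.algebraMap_mem c)⟩ : B₀)}))
    (h₁fib : IsReduced (B₁ ⧸ Ideal.span {(⟨t⁻¹, ht₁⟩ : B₁)}) ∧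
      IsArtinianRing (B₁ ⧸ Ideal.span {(⟨t⁻¹, ht₁⟩ : B₁)})) :
    K⟮t⟯ = ⊤ := by
  haveI : IsIntegrallyClosedIn K F := isIntegrallyClosedIn_of_isAlgClosed
  have hrat : ∀ P : PlaceOver K F, P.IsRational := PlaceOver.isRational_of_isAlgClosed
  have ht0 : t ≠ 0 := fun h ↦ ht ⟨0, by rw [h, map_zero]⟩
  refine adjoin_simple_eq_top_of_unramified hrat ht (fun P htP ↦ ?_) (fun P htP ↦ ?_)
  · -- finite place: `ϖ = t - t(P)` on the chart `B₀`
    set c := P.value t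
    have hball : t - algebraMap K F c ∈ P.ball 1 := (hrat P).sub_value_mem htP
    have hne : t - algebraMap K F c ≠ 0 := fun e ↦ ht ⟨c, (sub_eq_zero.1 e).symm⟩
    have hlt : P.valuation (t - algebraMap K F c) < 1 :=
      (P.valuation_lt_one_iff_ord_pos hne).2 ((P.mem_ball_iff_le_ord 1 hne).1 hball)
    haveI := (h₀fib c).1
    haveI := (h₀fib c).2
    exact P.ord_eq_one_of_isReduced (h₀O P htP) h₀frac
      (sub_mem ht₀ (B₀.algebraMap_mem c)) hne hlt
  · -- pole: `ϖ = t⁻¹` on the chart `B₁`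
    have hinvO : t⁻¹ ∈ P.toValuationSubring := (P.toValuationSubring.mem_or_inv_mem t).resolve_left htP
    have hlt : P.valuation t⁻¹ < 1 := by
      rw [map_inv₀, inv_lt_one₀ (by rwa [(P.valuation).pos_iff])]
      rwa [← not_le, P.toValuationSubring.valuation_le_one_iff]
    haveI := h₁fib.1
    haveI := h₁fib.2
    have h1 : P.ord t⁻¹ = 1 :=
      P.ord_eq_one_of_isReduced (h₁O P htP) h₁frac ht₁ (inv_ne_zero ht0) hlt
    rw [P.ord_inv ht0] at h1
    omega

end charts

end Literature.NumberTheory.DiophantineGeometry.AlgFunctionField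

end
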